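import Summits.Schanuel.Schanuel.Theses.RoyCriterion
import Summits.Schanuel.Schanuel.Theses.EclCore
import Summits.Schanuel.Schanuel.Theorems.RoyCriterionSchanuelTwoLineSketch
import Literature.NumberTheory.Transcendental.LindemannWeierstrassProofs
import Literature.NumberTheory.Transcendental.BWMain
import Literature.Barriers.Schanuel.LargeTranscendenceDegreeThm29Holds
import Literature.NumberTheory.Transcendental.KirbyWeakSchanuelAx
import Literature.NumberTheory.Transcendental.SchanuelEclEmptyProofs
import Literature.NumberTheory.Transcendental.PeriodsWave0NesterenkoProofs
import Literature.Barriers.Schanuel.NesterenkoModularScope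
import Literature.NumberTheory.Transcendental.TubbsPeriodsMain

/-!
# Line `CardA_BW` (idea `bw-log-rich-planes`) for crux stmt-Schanuel-0069 `SchanuelTwo` — the lead's skeleton

Crux: `Summit.Schanuel.Schanuel.Theses.RoyCriterion.SchanuelTwo`
(`∀ x : Fin 2 → ℂ, LinearIndependent ℚ x → 2 ≤ trdeg_ℚ ℚ(x, e^x)`; = `…Theses.EclCore.SchanuelTwo`,
same term): Schanuel's conjecture for `n = 2`.

The line (crux-ideate r2 ideator 5, `CardA_BW.lean` v3 + `Sketch.lean`; card
`Cruxes/SchanuelTwo/Ideas/bw-log-rich-planes.md`): the tree's two PROVED grid engines —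
Brownawell–Waldschmidt (`BrownawellWaldschmidt.brownawell_waldschmidt`, `(2,2)` grid with two algebraic
values sharing an index) and LNM 1752 Ch. 14 Thm 2.9 `t₂` (`Literature.Barriers.Schanuel.two_le_trdeg_gridField₂`,
`ℓ + d < dℓ`) — fire on configurations drawn from the exponential module `Λ(F_x) ⊋ span_ℚ(x)` of
`F_x = acl ℚ(x, e^x)`; everything algebraic over `K_x = ℚ(x, e^x)` is adjoined at no cost in `trdeg`. This
settles the LOG-RICH and GRID-RICH sectors unconditionally; composed with what the tree already proves at
`n = 2` (Hermite–Lindemann collapse and Lindemann–Weierstrass — landed p89549 / p87563; Nesterenko planes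
through `π`, `π√3` — Disproof §9; Kirby's reduction to `ecl(∅)²` — Disproof §8) the crux is reduced to the
residual `stub_rest`, which the card does NOT claim easier and the lead holds.

Composition: `SchanuelTwo_of : …RoyCriterion.SchanuelTwo` (and `SchanuelTwo_proof : …EclCore.SchanuelTwo`)
`:= stub_eclReduction (pointwise: collapse | LW | logRich | gridRich | Nesterenko plane | stub_rest)`.

Stubs (the only `sorry`s; worker stubs are spelled out def-free so landed theorems match them textually):
* `stub_logRichSector`   — B–W sector (CardA v3 `two_le_trdeg_SF_of_logRich`, kernel-checked) — worker.
* `stub_gridRichSector`  — Thm 2.9 `t₂` sector (grid `X : Fin d`, `Y : Fin ℓ`, `ℓ+d<dℓ`, algebraic over `K_x`) — worker.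
* `stub_nesterenkoPlanes` — planes through `π` or `π√3` (Disproof §9, kernel-checked) — worker.
* `stub_eclReduction`    — crux ⟸ its restriction to `ecl(∅)²` (Kirby 2010 Prop 7.2 at rank 2; Disproof §8) — worker.
* `stub_modularSector`   — (v2) two of `P(q), Q(q), R(q)` and `q` algebraic over `K_x`, `0<|q|<1` (Nesterenko Thm 1.1) — worker.
* `stub_gridExpSector`   — (v2) Thm 2.9 clauses `t`, `t₁` (only exponentials / exponentials + one side algebraic) — worker.
* `stub_periodSector`    — (v3; line CardB_Scale ABSORBED) a lattice basis `ω₁, ω₂` with `g₂, g₃`, a scale `c ≠ 0` and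
                           `e^{cω₁}, e^{cω₂}` all algebraic over `K_x` ⟹ `2 ≤ trdeg K_x`, stated with the named fact
                           `Tubbs1990_thm4_periods` (Tubbs 1990 Thm 4 / Chudnovsky 1984 Ch. 7 Thm 4.1 (i)) as hypothesis;
                           the fact is PROVED in tree (`Tubbs1990_thm4_periods_holds`, TubbsPeriodsMain.lean), so the
                           sector is used UNCONDITIONALLY below (v4) — worker.
* `stub_rest`            — the residual: pairs of depth-one seeds in `ecl(∅)²`, one transcendental, in no sector — LEAD.
(v1 → v2/v3 reshape after wave 1 landed all four v1 worker stubs p98157, p98594, p98250, p98381; v4 after wave 2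
landed p100772 stub_modularSector, p100720 stub_gridExpSector, p102652 stub_periodSector: ONLY `stub_rest` is open.)
-/

set_option linter.dupNamespace false

noncomputable section

open Complex IntermediateField
open Literature.NumberTheory.Transcendental (ecl)
open Summit.Schanuel.Schanuel.Theses.RoyCriterion (SchanuelTwo)

namespace Summit.Schanuel.Schanuel.Cruxes.SchanuelTwo.LineCardABW

/-! ### §0 Objects -/

/-- The Schanuel field `K_x = ℚ(x, e^x)` of a pair, as in the crux. -/
abbrev SF (x : Fin 2 → ℂ) : IntermediateField ℚ ℂ :=
  adjoin ℚ (Set.range x ∪ Set.range (Complex.exp ∘ x))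

/-- **Log-rich sector** (card A, verbatim): two `ℚ`-independent logarithms of algebraic numbers `l₁, l₂`
and a multiplier `μ` with `(1, μ)` `ℚ`-independent, all algebraic over `K_x`, with `e^{μ l₁}, e^{μ l₂}`
algebraic over `K_x` (a Brownawell–Waldschmidt grid `X = (1, μ)`, `Y = (l₁, l₂)` inside `acl K_x`). -/
def LogRich (x : Fin 2 → ℂ) : Prop :=
  ∃ l₁ l₂ μ : ℂ, IsAlgebraic ℚ (cexp l₁) ∧ IsAlgebraic ℚ (cexp l₂) ∧
    LinearIndependent ℚ ![l₁, l₂] ∧ LinearIndependent ℚ ![(1 : ℂ), μ] ∧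
    IsAlgebraic (SF x) l₁ ∧ IsAlgebraic (SF x) l₂ ∧ IsAlgebraic (SF x) μ ∧
    IsAlgebraic (SF x) (cexp (μ * l₁)) ∧ IsAlgebraic (SF x) (cexp (μ * l₂))

/-- **Grid-rich sector** (card A, `(2,3)` family generalised): a `d × ℓ` grid with `ℓ + d < dℓ`,
`ℚ`-independent sides, all of `X, Y, e^{XᵢYⱼ}` algebraic over `K_x` (LNM 1752 Ch. 14 Thm 2.9 `t₂`). -/
def GridRich (x : Fin 2 → ℂ) : Prop :=
  ∃ (d l : ℕ) (X : Fin d → ℂ) (Y : Fin l → ℂ), l + d < d * l ∧ LinearIndependent ℚ X ∧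
    LinearIndependent ℚ Y ∧ (∀ i, IsAlgebraic (SF x) (X i)) ∧ (∀ j, IsAlgebraic (SF x) (Y j)) ∧
    ∀ i j, IsAlgebraic (SF x) (cexp (X i * Y j))

/-- **Nesterenko planes**: the `ℚ`-plane `span_ℚ(x)` contains `π` or `π√3` (Disproof §9). -/
def NesterenkoPlane (x : Fin 2 → ℂ) : Prop :=
  (Real.pi : ℂ) ∈ Submodule.span ℚ (Set.range x) ∨
    ((Real.pi * Real.sqrt 3 : ℝ) : ℂ) ∈ Submodule.span ℚ (Set.range x)

/-- **Modular-rich sector** (v2; engine: Nesterenko 1996 Thm 1.1, PROVED in tree as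
`Literature.Barriers.Schanuel.nesterenko1996_thm_1_1_holds`: `trdeg ℚ(q, P(q), Q(q), R(q)) ≥ 3` for
`0 < |q| < 1`): some `q` with `0 < |q| < 1` and TWO of Ramanujan's `P(q), Q(q), R(q)` are algebraic over
`K_x` (then `3 ≤ trdeg K_x(q, P, Q, R) ≤ trdeg K_x + 1`). Contains every Nesterenko plane (`q = e^{-2π}`,
`R = 0`, `P = 3/π`; `q = -e^{-π√3}`, `Q = 0`) and the CM-modular planes. -/
def ModularRich (x : Fin 2 → ℂ) : Prop :=
  ∃ q u v w : ℂ, 0 < ‖q‖ ∧ ‖q‖ < 1 ∧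
    ({u, v, w} : Set ℂ) = {Literature.Barriers.Schanuel.ramanujanP q,
      Literature.Barriers.Schanuel.ramanujanQ q, Literature.Barriers.Schanuel.ramanujanR q} ∧
    IsAlgebraic (SF x) q ∧ IsAlgebraic (SF x) u ∧ IsAlgebraic (SF x) v

/-- **Grid-exp-rich sector** (v2; engine: LNM 1752 Ch. 14 Thm 2.9 clauses `t` and `t₁`, PROVED in tree
as `Literature.Barriers.Schanuel.smallTrdeg_thm_2_9_pos_holds`): a `d × ℓ` grid (`d, ℓ ≥ 1`) with
`ℚ`-independent sides whose EXPONENTIALS `e^{XᵢYⱼ}` are algebraic over `K_x`, and either `2(ℓ+d) ≤ dℓ`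
(nothing else required) or `d + 2ℓ ≤ dℓ` and the side `X` algebraic over `K_x` (the side `Y` is free). -/
def GridExpRich (x : Fin 2 → ℂ) : Prop :=
  ∃ (d l : ℕ) (X : Fin d → ℂ) (Y : Fin l → ℂ), 1 ≤ d ∧ 1 ≤ l ∧ LinearIndependent ℚ X ∧
    LinearIndependent ℚ Y ∧ (∀ i j, IsAlgebraic (SF x) (cexp (X i * Y j))) ∧
    (2 * (l + d) ≤ d * l ∨ (d + 2 * l ≤ d * l ∧ ∀ i, IsAlgebraic (SF x) (X i)))

/-- **Period-rich sector** (v3 = line CardB_Scale absorbed; engine: Tubbs 1990 Thm 4 (periods form) =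
Chudnovsky 1984 Ch. 7 Thm 4.1 (i), `trdeg ℚ(g₂, g₃, ω₁, ω₂, c, e^{cω₁}, e^{cω₂}) ≥ 2` for every lattice basis and
every `c ≠ 0` — PROVED in tree as `Literature.NumberTheory.Transcendental.Tubbs1990_thm4_periods_holds`
(TubbsPeriodsMain.lean)): a lattice basis, its invariants, a non-zero scale and the two exponentials
`e^{cωᵢ}`, all algebraic over `K_x`. Contains CardB's planes `c • (ω₁, ω₂)` (`g₂, g₃ ∈ ℚ̄`,
`c` algebraic over `K_x`) and support item stmt-Schanuel-14661 (`c = 1`). -/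
def PeriodRich (x : Fin 2 → ℂ) : Prop :=
  ∃ (L : PeriodPair) (c : ℂ), c ≠ 0 ∧ IsAlgebraic (SF x) L.g₂ ∧ IsAlgebraic (SF x) L.g₃ ∧
    IsAlgebraic (SF x) L.ω₁ ∧ IsAlgebraic (SF x) L.ω₂ ∧ IsAlgebraic (SF x) c ∧
    IsAlgebraic (SF x) (cexp (c * L.ω₁)) ∧ IsAlgebraic (SF x) (cexp (c * L.ω₂))

/-- **Pairs of depth-one seeds**: `trdeg ℚ(x i, e^{x i}) = 1` for both coordinates (after the
Hermite–Lindemann collapse only these pairs remain). -/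
def DepthOnePair (x : Fin 2 → ℂ) : Prop :=
  ∀ i, Algebra.trdeg ℚ ↥(adjoin ℚ ({x i, cexp (x i)} : Set ℂ)) = 1

/-! ### §1 Stubs (the only `sorry`s of this file) -/

/-- **Stub (worker): the log-rich sector** — B–W configuration algebraic over `K_x` ⟹ `2 ≤ trdeg K_x`.
Source: CardA v3 `two_le_trdeg_of_bwConfig` + `two_le_trdeg_SF_of_logRich` (kernel-checked). -/
theorem stub_logRichSector :
    ∀ (x : Fin 2 → ℂ) (l₁ l₂ μ : ℂ), IsAlgebraic ℚ (Complex.exp l₁) → IsAlgebraic ℚ (Complex.exp l₂) →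
      LinearIndependent ℚ ![l₁, l₂] → LinearIndependent ℚ ![(1 : ℂ), μ] →
      IsAlgebraic ↥(IntermediateField.adjoin ℚ (Set.range x ∪ Set.range (Complex.exp ∘ x))) l₁ →
      IsAlgebraic ↥(IntermediateField.adjoin ℚ (Set.range x ∪ Set.range (Complex.exp ∘ x))) l₂ →
      IsAlgebraic ↥(IntermediateField.adjoin ℚ (Set.range x ∪ Set.range (Complex.exp ∘ x))) μ →
      IsAlgebraic ↥(IntermediateField.adjoin ℚ (Set.range x ∪ Set.range (Complex.exp ∘ x)))
        (Complex.exp (μ * l₁)) →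
      IsAlgebraic ↥(IntermediateField.adjoin ℚ (Set.range x ∪ Set.range (Complex.exp ∘ x)))
        (Complex.exp (μ * l₂)) →
      (2 : Cardinal) ≤ Algebra.trdeg ℚ
        ↥(IntermediateField.adjoin ℚ (Set.range x ∪ Set.range (Complex.exp ∘ x))) := by
  -- CLOSED: landed p98157 (Theorems/RoyCriterionSchanuelTwoStubLogRichSector.lean) = Theorems.stub_logRichSector
  sorry

/-- **Stub (worker): the grid-rich sector** — a `d × ℓ` grid with `ℓ + d < dℓ`, `ℚ`-independent sides,
everything algebraic over `K_x` ⟹ `2 ≤ trdeg K_x`. Engine: `Literature.Barriers.Schanuel.two_le_trdeg_gridField₂`. -/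
theorem stub_gridRichSector :
    ∀ (x : Fin 2 → ℂ) (d l : ℕ) (X : Fin d → ℂ) (Y : Fin l → ℂ), l + d < d * l →
      LinearIndependent ℚ X → LinearIndependent ℚ Y →
      (∀ i, IsAlgebraic ↥(IntermediateField.adjoin ℚ (Set.range x ∪ Set.range (Complex.exp ∘ x))) (X i)) →
      (∀ j, IsAlgebraic ↥(IntermediateField.adjoin ℚ (Set.range x ∪ Set.range (Complex.exp ∘ x))) (Y j)) →
      (∀ i j, IsAlgebraic ↥(IntermediateField.adjoin ℚ (Set.range x ∪ Set.range (Complex.exp ∘ x)))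
        (Complex.exp (X i * Y j))) →
      (2 : Cardinal) ≤ Algebra.trdeg ℚ
        ↥(IntermediateField.adjoin ℚ (Set.range x ∪ Set.range (Complex.exp ∘ x))) := by
  -- CLOSED: landed p98594 (Theorems/RoyCriterionSchanuelTwoStubGridRichSector.lean) = Theorems.stub_gridRichSector
  sorry

/-- **Stub (worker): Nesterenko planes** — if `span_ℚ(x)` contains `π` or `π√3` then `2 ≤ trdeg K_x`
(Nesterenko 1996 at `τ = i`, `ρ`; Disproof §9 `schanuelTwo_of_pi_mem_span`,
`schanuelTwo_of_pi_mul_sqrt_three_mem_span`, kernel-checked). -/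
theorem stub_nesterenkoPlanes :
    ∀ x : Fin 2 → ℂ, ((Real.pi : ℂ) ∈ Submodule.span ℚ (Set.range x) ∨
        ((Real.pi * Real.sqrt 3 : ℝ) : ℂ) ∈ Submodule.span ℚ (Set.range x)) →
      (2 : Cardinal) ≤ Algebra.trdeg ℚ
        ↥(IntermediateField.adjoin ℚ (Set.range x ∪ Set.range (Complex.exp ∘ x))) := by
  -- CLOSED: landed p98250 (Theorems/RoyCriterionSchanuelTwoStubNesterenkoPlanes.lean) = Theorems.stub_nesterenkoPlanes
  sorry

/-- **Stub (worker): Kirby's reduction at rank 2** — the crux follows from its restriction to pairs of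
exponentially algebraic numbers (`ecl(∅)²`). (Kirby 2010 Prop. 7.2; Disproof §8 `schanuelTwo_iff_ecl`,
kernel-checked from the tree's `kirby_relative_schanuel_complex_holds`.) -/
theorem stub_eclReduction :
    (∀ x : Fin 2 → ℂ, (∀ i, x i ∈ Literature.NumberTheory.Transcendental.ecl (∅ : Set ℂ)) →
        LinearIndependent ℚ x →
        (2 : Cardinal) ≤ Algebra.trdeg ℚ
          ↥(IntermediateField.adjoin ℚ (Set.range x ∪ Set.range (Complex.exp ∘ x)))) →
      Summit.Schanuel.Schanuel.Theses.RoyCriterion.SchanuelTwo := by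
  -- CLOSED: landed p98381 (Theorems/RoyCriterionSchanuelTwoStubEclReduction.lean) = Theorems.stub_eclReduction
  sorry

/-- **Stub (worker, v2): the modular-rich sector** — `0 < |q| < 1`, `{u, v, w} = {P(q), Q(q), R(q)}`,
and `q, u, v` algebraic over `K_x` ⟹ `2 ≤ trdeg K_x`. Engine:
`Literature.Barriers.Schanuel.nesterenko1996_thm_1_1_holds` (`3 ≤ trdeg ℚ(q, P(q), Q(q), R(q))`), the
tower `trdeg K_x(q,u,v)(w) ≤ trdeg K_x(q,u,v) + 1 = trdeg K_x + 1`. -/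
theorem stub_modularSector :
    ∀ (x : Fin 2 → ℂ) (q u v w : ℂ), 0 < ‖q‖ → ‖q‖ < 1 →
      ({u, v, w} : Set ℂ) = {Literature.Barriers.Schanuel.ramanujanP q,
        Literature.Barriers.Schanuel.ramanujanQ q, Literature.Barriers.Schanuel.ramanujanR q} →
      IsAlgebraic ↥(IntermediateField.adjoin ℚ (Set.range x ∪ Set.range (Complex.exp ∘ x))) q →
      IsAlgebraic ↥(IntermediateField.adjoin ℚ (Set.range x ∪ Set.range (Complex.exp ∘ x))) u →
      IsAlgebraic ↥(IntermediateField.adjoin ℚ (Set.range x ∪ Set.range (Complex.exp ∘ x))) v →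
      (2 : Cardinal) ≤ Algebra.trdeg ℚ
        ↥(IntermediateField.adjoin ℚ (Set.range x ∪ Set.range (Complex.exp ∘ x))) := by
  -- CLOSED: landed p100772 (Theorems/RoyCriterionSchanuelTwoStubModularSector.lean) = Theorems.stub_modularSector
  sorry

/-- **Stub (worker, v2): the grid-exp-rich sector** — Thm 2.9 clauses `t` (`2(ℓ+d) ≤ dℓ`, only the
exponentials algebraic over `K_x`) and `t₁` (`d + 2ℓ ≤ dℓ`, exponentials and the side `X` algebraic
over `K_x`). Engine: `Literature.Barriers.Schanuel.smallTrdeg_thm_2_9_pos_holds` (fields `gridField`,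
`gridField₁`). -/
theorem stub_gridExpSector :
    ∀ (x : Fin 2 → ℂ) (d l : ℕ) (X : Fin d → ℂ) (Y : Fin l → ℂ), 1 ≤ d → 1 ≤ l →
      LinearIndependent ℚ X → LinearIndependent ℚ Y →
      (∀ i j, IsAlgebraic ↥(IntermediateField.adjoin ℚ (Set.range x ∪ Set.range (Complex.exp ∘ x)))
        (Complex.exp (X i * Y j))) →
      (2 * (l + d) ≤ d * l ∨ (d + 2 * l ≤ d * l ∧
        ∀ i, IsAlgebraic ↥(IntermediateField.adjoin ℚ (Set.range x ∪ Set.range (Complex.exp ∘ x)))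
          (X i))) →
      (2 : Cardinal) ≤ Algebra.trdeg ℚ
        ↥(IntermediateField.adjoin ℚ (Set.range x ∪ Set.range (Complex.exp ∘ x))) := by
  -- CLOSED: landed p100720 (Theorems/RoyCriterionSchanuelTwoStubGridExpSector.lean) = Theorems.stub_gridExpSector
  sorry

/-- **Stub (worker, v3): the period-rich sector modulo Tubbs 1990 Thm 4** — a lattice basis `ω₁, ω₂`,
its invariants `g₂, g₃`, a scale `c ≠ 0` and `e^{cω₁}, e^{cω₂}` all algebraic over `K_x` ⟹ `2 ≤ trdeg K_x`,
given `h : Tubbs1990_thm4_periods` (the registered signature keeps the fact as a hypothesis; it is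
discharged below by the tree theorem `Tubbs1990_thm4_periods_holds`; the stub is line CardB_Scale's
`two_le_trdeg_SF_scale` in sector form). -/
theorem stub_periodSector :
    Literature.NumberTheory.Transcendental.Tubbs1990_thm4_periods →
    ∀ (x : Fin 2 → ℂ) (L : PeriodPair) (c : ℂ), c ≠ 0 →
      IsAlgebraic ↥(IntermediateField.adjoin ℚ (Set.range x ∪ Set.range (Complex.exp ∘ x))) L.g₂ →
      IsAlgebraic ↥(IntermediateField.adjoin ℚ (Set.range x ∪ Set.range (Complex.exp ∘ x))) L.g₃ →
      IsAlgebraic ↥(IntermediateField.adjoin ℚ (Set.range x ∪ Set.range (Complex.exp ∘ x))) L.ω₁ →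
      IsAlgebraic ↥(IntermediateField.adjoin ℚ (Set.range x ∪ Set.range (Complex.exp ∘ x))) L.ω₂ →
      IsAlgebraic ↥(IntermediateField.adjoin ℚ (Set.range x ∪ Set.range (Complex.exp ∘ x))) c →
      IsAlgebraic ↥(IntermediateField.adjoin ℚ (Set.range x ∪ Set.range (Complex.exp ∘ x)))
        (Complex.exp (c * L.ω₁)) →
      IsAlgebraic ↥(IntermediateField.adjoin ℚ (Set.range x ∪ Set.range (Complex.exp ∘ x)))
        (Complex.exp (c * L.ω₂)) →
      (2 : Cardinal) ≤ Algebra.trdeg ℚ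
        ↥(IntermediateField.adjoin ℚ (Set.range x ∪ Set.range (Complex.exp ∘ x))) := by
  -- CLOSED: landed p102652 (Theorems/RoyCriterionSchanuelTwoStubPeriodSector.lean) = Theorems.stub_periodSector
  sorry

/-- **Stub (LEAD): the residual.** A `ℚ`-free pair of depth-one seeds from `ecl(∅)`, one of them
transcendental, that is neither log-rich nor grid-rich nor grid-exp-rich nor modular-rich nor on a
Nesterenko plane nor period-rich, has `2 ≤ trdeg K_x`. This is the crux off every sector the tree can
settle; NOT claimed easier (cards A, B). -/
theorem stub_rest :
    ∀ x : Fin 2 → ℂ, (∀ i, x i ∈ ecl (∅ : Set ℂ)) → LinearIndependent ℚ x →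
      (∃ i, Transcendental ℚ (x i)) → DepthOnePair x → ¬ LogRich x → ¬ GridRich x →
      ¬ NesterenkoPlane x → ¬ ModularRich x → ¬ GridExpRich x → ¬ PeriodRich x →
      (2 : Cardinal) ≤ Algebra.trdeg ℚ (SF x) := by
  sorry

/-! ### §2 Sector lemmas in the line's vocabulary (sorry-free given the stubs) -/

/-- Hermite–Lindemann collapse, pointwise: a `ℚ`-free pair with a coordinate that is NOT a depth-one
seed already has `2 ≤ trdeg K_x` (landed lemmas of p89549). -/
theorem two_le_trdeg_SF_of_not_depthOnePair (x : Fin 2 → ℂ) (hx : LinearIndependent ℚ x)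
    (h : ¬ DepthOnePair x) : (2 : Cardinal) ≤ Algebra.trdeg ℚ (SF x) := by
  unfold DepthOnePair at h
  push Not at h
  obtain ⟨i, hi⟩ := h
  have h2 : (2 : Cardinal) ≤ Algebra.trdeg ℚ ↥(adjoin ℚ ({x i, cexp (x i)} : Set ℂ)) :=
    (Theorems.schanuelTwo_two_le_iff_ne_one
      (Theorems.schanuelTwo_one_le_trdeg_seed (hx.ne_zero i))).mpr hi
  exact h2.trans (Literature.Barriers.Schanuel.trdeg_mono (Theorems.schanuelTwo_adjoin_seed_le x i))

/-- Lindemann–Weierstrass sector, pointwise (same proof as the landed stub p87563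
`Summit.Schanuel.Schanuel.Theorems.stub_purityAlgebraic`, inlined to keep this file's imports built). -/
theorem two_le_trdeg_SF_of_isAlgebraic (x : Fin 2 → ℂ) (hx : LinearIndependent ℚ x)
    (halg : ∀ i, IsAlgebraic ℚ (x i)) : (2 : Cardinal) ≤ Algebra.trdeg ℚ (SF x) := by
  have hind : AlgebraicIndependent ℚ (fun i => cexp (x i)) :=
    Literature.NumberTheory.Transcendental.algebraicIndependent_exp_holds x halg hx
  let y : Fin 2 → SF x := fun i => ⟨cexp (x i), subset_adjoin ℚ _ (Or.inr ⟨i, rfl⟩)⟩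
  have hy : AlgebraicIndependent ℚ y := AlgebraicIndependent.of_comp (SF x).val hind
  simpa using hy.cardinalMk_le_trdeg

/-- Log-rich sector from its stub. -/
theorem two_le_trdeg_SF_of_logRich (x : Fin 2 → ℂ) (h : LogRich x) :
    (2 : Cardinal) ≤ Algebra.trdeg ℚ (SF x) := by
  obtain ⟨l₁, l₂, μ, ha1, ha2, hli, hirr, hl1, hl2, hμ, hm1, hm2⟩ := h
  exact stub_logRichSector x l₁ l₂ μ ha1 ha2 hli hirr hl1 hl2 hμ hm1 hm2

/-- Grid-rich sector from its stub. -/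
theorem two_le_trdeg_SF_of_gridRich (x : Fin 2 → ℂ) (h : GridRich x) :
    (2 : Cardinal) ≤ Algebra.trdeg ℚ (SF x) := by
  obtain ⟨d, l, X, Y, hdl, hX, hY, hXa, hYa, hE⟩ := h
  exact stub_gridRichSector x d l X Y hdl hX hY hXa hYa hE

/-- Nesterenko planes from their stub. -/
theorem two_le_trdeg_SF_of_nesterenkoPlane (x : Fin 2 → ℂ) (h : NesterenkoPlane x) :
    (2 : Cardinal) ≤ Algebra.trdeg ℚ (SF x) :=
  stub_nesterenkoPlanes x h

/-- Modular-rich sector from its stub. -/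
theorem two_le_trdeg_SF_of_modularRich (x : Fin 2 → ℂ) (h : ModularRich x) :
    (2 : Cardinal) ≤ Algebra.trdeg ℚ (SF x) := by
  obtain ⟨q, u, v, w, hq0, hq1, huvw, hq, hu, hv⟩ := h
  exact stub_modularSector x q u v w hq0 hq1 huvw hq hu hv

/-- Period-rich sector from its stub, UNCONDITIONALLY (Tubbs' theorem is the tree theorem
`Literature.NumberTheory.Transcendental.Tubbs1990_thm4_periods_holds`). -/
theorem two_le_trdeg_SF_of_periodRich (x : Fin 2 → ℂ) (h : PeriodRich x) :
    (2 : Cardinal) ≤ Algebra.trdeg ℚ (SF x) := by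
  obtain ⟨L, c, hc, h2, h3, hw1, hw2, hca, he1, he2⟩ := h
  exact stub_periodSector Literature.NumberTheory.Transcendental.Tubbs1990_thm4_periods_holds
    x L c hc h2 h3 hw1 hw2 hca he1 he2

/-- Grid-exp-rich sector from its stub. -/
theorem two_le_trdeg_SF_of_gridExpRich (x : Fin 2 → ℂ) (h : GridExpRich x) :
    (2 : Cardinal) ≤ Algebra.trdeg ℚ (SF x) := by
  obtain ⟨d, l, X, Y, hd, hl, hX, hY, hE, hnum⟩ := h
  exact stub_gridExpSector x d l X Y hd hl hX hY hE hnum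

/-! ### §3 Composition: the line closes the crux modulo the stubs -/

/-- The crux pointwise on `ecl(∅)²`, by the sector atlas and the residual stub. -/
theorem two_le_trdeg_SF_of_mem_ecl (x : Fin 2 → ℂ) (hecl : ∀ i, x i ∈ ecl (∅ : Set ℂ))
    (hx : LinearIndependent ℚ x) : (2 : Cardinal) ≤ Algebra.trdeg ℚ (SF x) := by
  by_cases hD : DepthOnePair x
  swap
  · exact two_le_trdeg_SF_of_not_depthOnePair x hx hD
  by_cases halg : ∀ i, IsAlgebraic ℚ (x i)
  · exact two_le_trdeg_SF_of_isAlgebraic x hx halg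
  push Not at halg
  obtain ⟨i, hi⟩ := halg
  by_cases hA : LogRich x
  · exact two_le_trdeg_SF_of_logRich x hA
  by_cases hB : GridRich x
  · exact two_le_trdeg_SF_of_gridRich x hB
  by_cases hC : NesterenkoPlane x
  · exact two_le_trdeg_SF_of_nesterenkoPlane x hC
  by_cases hM : ModularRich x
  · exact two_le_trdeg_SF_of_modularRich x hM
  by_cases hG : GridExpRich x
  · exact two_le_trdeg_SF_of_gridExpRich x hG
  by_cases hP : PeriodRich x
  · exact two_le_trdeg_SF_of_periodRich x hP
  exact stub_rest x hecl hx ⟨i, hi⟩ hD hA hB hC hM hG hP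

/-- **The crux by name** (route `RoyCriterion`). -/
theorem SchanuelTwo_of : Summit.Schanuel.Schanuel.Theses.RoyCriterion.SchanuelTwo :=
  stub_eclReduction two_le_trdeg_SF_of_mem_ecl

/-- **The crux by name** (route `EclCore`, same term). -/
theorem SchanuelTwo_proof : Summit.Schanuel.Schanuel.Theses.EclCore.SchanuelTwo :=
  SchanuelTwo_of

/-! ### §4 Certificate (sorry-free apart from the stubs it names): the residual is implied by the crux -/

/-- The residual stub is a restriction of the crux (so it is not stronger than the crux). -/
theorem rest_of_schanuelTwo (hS : SchanuelTwo) :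
    ∀ x : Fin 2 → ℂ, (∀ i, x i ∈ ecl (∅ : Set ℂ)) → LinearIndependent ℚ x →
      (∃ i, Transcendental ℚ (x i)) → DepthOnePair x → ¬ LogRich x → ¬ GridRich x →
      ¬ NesterenkoPlane x → ¬ ModularRich x → ¬ GridExpRich x → ¬ PeriodRich x →
      (2 : Cardinal) ≤ Algebra.trdeg ℚ (SF x) :=
  fun x _ hx _ _ _ _ _ _ _ _ => hS x hx

/-- Whatever closes the skeleton proves the algebraic independence of `e` and `π` (landed p89549). -/
theorem expOnePi_of_line : Literature.NumberTheory.Transcendental.ExpOnePiAlgebraicIndependent :=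
  Theorems.expOnePiAlgebraicIndependent_of_schanuelTwo SchanuelTwo_of

end Summit.Schanuel.Schanuel.Cruxes.SchanuelTwo.LineCardABW

end
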